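import Summits.QuantumFields.BalabanUV.T4Continuum.Spine.NE1p.DressedSmallFieldOnCoresMass
import Summits.QuantumFields.BalabanUV.T4Continuum.Spine.NE1p.DressedSmallFieldCoresWitness

/-!
# T⁴ programme, spine estimate NE1′ (node O3b/H2) — WITNESS W35 (DAG N29zp) «THE LETTER-LEVEL MASS BUDGET FIRES ON THE LIVE CORE»: the
# owner's N0q ENDs `attachedPart_locE_le_of_cores_pencil_mass` and `muPart_locE_le_of_cores_mass` APPLIED ONCE EACH BY NAME on W33's live
# (2.14)-core of the FORMAT of record; the table-blind LETTER mass `|c|·√(2π)` vs W33's EXACT Gaussian mass `|c|·√π` — the located `√2`;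
# (B3)-at-letters met at W24's located constant by the weight `c∕√2`; the attached part AND the μ-part are NOT zero

Cell `pub-balaban`, sub-cell `t4`, BINDER-OWNERS row NE1′, crew `b2b-balaban-t4-ne1p-formalise-*`, seat `…-leaf-09` (gen 10; lineage S3∕S3g–S3l∕S3u∕
W5c∕W14∕W20); INTENT `HOME/CLAIMS.log` l.17057, owner t4-ne1p-p1 g28 «GO — NOT MINE» l.17122, BOOKED typer R-T113 (iii-b) l.17273 (W35 = N29zp;
X129).  ADDITIVE — imports the owner's N0q `Spine/NE1p/DressedSmallFieldOnCoresMass` (g28: the letter-budget ENDs) and W33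
`Spine/NE1p/DressedSmallFieldCoresWitness` (leaf-10-g8, p225894: `coreW`∕`coreFam`, `liveTable`, `paramMass_coreW`, the Gaussian∕integrability
kit on `E1`, `termsW`, `hsmall_W`, `Acst`, `incr`) ONLY — through them N0p, W24, row NE5's `B13HistWitness`; toy DATA `def`s (`cM`, `actM`) +
theorems; nothing of N0q ∕ N0p ∕ W33 ∕ W24 ∕ row NE5 is restated — their declarations are used BY NAME.

WHY.  N0q reads N0p §4's (B3) binder `hL3` (the (2.38)-shape of the parameter-mass INTEGRALS of the cores) off the cores' SCALAR LETTERS —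
`hM3 : Σ_i λ_i(univ)·(wB_i·N₀_i·e^{bq_i})·(π∕(mq_i∕2))^{dim α_i∕2}·e^{N₁,i·R₀} ≤ (A₀ + ϱA₁)·e^{−R d(Z)}`, row NE5's `paramMass` currency — and
supplies the cores' μ-part twins N0p left to the reader; none of these ENDs had an applier (W33 fires N0p §4 with the EXACT mass; W31 fires
N0p §3 on a non-`BiCore`; S27 re-homes N0p's ENDs on the torus).  THIS FILE fires them on W33's decided core and LOCATES what the letter
route costs there: §1 the letter mass of `coreW c r` at NE5's toy letters `(mq, bq, N₀) = (1, 0, 1)` is `1·(|c|·1·e⁰)·(π∕(1∕2))^{1∕2} =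
|c|·√(2π)` (`letterMass_coreW`; `finrank E1 = 1`, `Real.sqrt_eq_rpow`) = EXACTLY `√2 ×` W33's Gaussian mass `|c|·√π` (`letterMass_eq_sqrt_two_mul`;
the half-margin majorant `e^{−(m∕2)‖v‖²}` behind `OutputRateOpGaussianParam.integral_paramMajorant` costs `(2π∕π)^{1∕2}` per real fluctuation
dimension); §2 the weight meeting the LETTER budget at W24's located `A` is `cM r := A·e^{−2r}∕√(2π) = cW r∕√2` (`cM_eq_cW_div`); the activity
`actM` = the sum of the cores' terms at weight `cM` along `s ↦ 0 + s • liveTable` (BY DEFINITION — `hact`∕`hscale` by `rfl`, as W33); §3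
`hM3_M` (table-strength pencil, `ϱ = 2`, `R₀ = ‖0‖ + 2‖liveTable‖`: `A·e^{−2r(1−‖liveTable‖)} ≤ A = 0 + 2·(A∕2)`, SLACK as in W33) and `hM3_mu`
(source pencil, `R₀ = 2`, constant `A`: `|cM|√(2π)·e^{2r} = A`, EQUALITY); decay factor `1` at `X₀` (`d(X₀) = 0`, `torusTreeLen_singleton`),
vacuous off `X₀`; §4 `coresMassEnd_fires` = N0q `attachedPart_locE_le_of_cores_pencil_mass (tsys 4 N) (tgeometry 4 N) (coreFam (cM r) r hr)`
ONCE BY NAME (W33's `hroom0`∕`ctr0`, NE5's toy letters INLINE in the literal binder shapes, the two pencil radius inequalities, W24's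
`hrate_torus`, W33's `hsmall_W`), closed form `≤ 2·K₀(64,8)`; `coresMuEnd_fires` = N0q `muPart_locE_le_of_cores_mass` ONCE BY NAME along the
SOURCE pencil on `‖s‖ < μ₁ ≤ 2`, `0 < μ₀ < μ₁`, `‖μ‖ ≤ μ₀`, closed form `≤ K₀(64,8)·μ₀∕(μ₁ − μ₀)` (N0q derives `…_cores_mass` FROM the
`hL3`-twin `muPart_locE_le_of_cores`, which therefore elaborates inside this call; its stand-alone exact-mass firing — `|cM|√π·e^{2r} =
A∕√2 ≤ A`, rc 0 in the reader packet's prototype — is left out for the line cap); §5 GENUINE: `termBi_coreFam_M` (the term at weight `cM` in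
closed form), `actM_real_sub_zero` (`act t X₀ − act 0 X₀ = cM·∫ incr (t·r)` for a REAL source `t`: W33's increment density at contour radius
`t·r`), `actM_mu_live`∕`actM_live` (`cM > 0`, W33's `integral_incr_pos`), `norm_actM_X₀_lt_one` (`‖act s X₀‖ < 1` on `‖s‖ ≤ 2`: `A ≤ 1`,
`√π < √(2π)`), **`coresMuEnd_live`** (real sources `0 < t ≤ 2`) and **`coresMassEnd_live`** (`t = 1`) via W24's `exp_locE_cube`.

HONEST FRAMING (c3∕c4∕c6∕k1–k3; wording = INTENT l.17057 (g) ACCEPTED R-T113 + the typer's rider, verbatim).  A WITNESS: it «exercises N0q's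
letter-budget ENDs (N0p §4's cores END and its μ-part twin with (B3) read on the cores' SCALAR LETTERS via row NE5's `paramMass` currency)
on W33's ONE decided `BiCore` over row NE5's TOY frame with NE5's DECOUPLED toy letters — a THEOREM-backed instance of the FORMAT of record;
the located `√2` is the toy's comparison of Mathlib's two Gaussian integrals (`√π` exact vs `(2π)^{1∕2}` from the half-margin majorant),
NOT a statement about Bałaban's (2.14) terms, rows NE2∕NE3's Gaussian data, the substrate's `slotsOfRecord` or any fluctuation covariance
of print; (B1b) by definition of the toy activity; (B3) = G-ne9p2-5 stays UNPRINTED for Bałaban's cores — `hM3` is its letter-level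
DISPLAY, not a discharge; (B5)∕geometry-for-Bałaban's-densities∕step-link DISPLAYED; 0 binders instantiated on Bałaban's densities; no
wall item; R-t4r2-Q2 NOT met thereby; NE1′ NOT proved ∕ NOT printed; spine PROVED 0∕9; finite T⁴ — NOT infinite volume, NOT mass gap, NOT
OS on ℝ⁴, NOT Clay».  RIDER (R-T113 (iii-b)): «the located √2 = (2π∕π)^{1∕2} compares Mathlib's exact Gaussian on `E1` with row NE5's
half-margin majorant `integral_paramMajorant` — OUR toy arithmetic; no numeral of print; not a constant of [Balaban1988RGII]».  Every
constant is W24's ∕ pv22's located torus letter (`A = (e·K₀(64,8)·9·64)⁻¹`, `ν = 9`, `c₁ = 64`, `κ₀ = 64·log 162`), W33's toy letters (`r`,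
`ϱ = 2`, class radii `(1, 2)`) or Mathlib's `√2`, `√π`; [decided toy] ∕ [folklore]; no placeholders; no citations (the bracketed name is a
label); no internally-minted statement becomes a cited fact (ABSOLUTE RULE).  HONEST DEPENDENCY: continuum YM on T⁴ ⇐ BetaPertH ∧ nine
spine estimates (0/9 proved); BetaPertH ⇐ (D1) ∧ (D4) ∧ CAP+tail; G-an2-4 gates asym, D1 and NE2/3/4.
-/

noncomputable section

namespace Summit.QuantumFields.BalabanUV.T4Continuum.NE1p.DressedSmallFieldCoresMassWitness

open Set Metric MeasureTheory Complex
open scoped BigOperators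
open Literature.MathematicalPhysics.QuantumFieldTheory.Balaban1983to89
open Literature.MathematicalPhysics.QuantumFieldTheory.Balaban1983to89.B12TreeDecay (K₀ K₀_pos)
open Literature.MathematicalPhysics.QuantumFieldTheory.Balaban1983to89.B13Resummation (locE)
open Literature.MathematicalPhysics.QuantumFieldTheory.Balaban1983to89.TreeLengthTorus (TDom tsys torusTreeLen torusTreeLen_singleton)
open Literature.MathematicalPhysics.QuantumFieldTheory.Balaban1983to89.TreeLengthTorusGeometry (tgeometry TTouch)
open Summit.QuantumFields.BalabanUV.T4Continuum.B13HistMeasurable (B13HistM)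
open Summit.QuantumFields.BalabanUV.T4Continuum.B13HistWitness (toyFrame)
open Summit.QuantumFields.BalabanUV.T4Continuum.B13TermParamGaussianBi (BiCore termBi)
open Summit.QuantumFields.BalabanUV.T4Continuum.NE1p.DressedSmallFieldTorusWitness (X₀ X₀_val eq_X₀_iff hrate_torus
  dressedConst_le_one exp_locE_cube)
open Summit.QuantumFields.BalabanUV.T4Continuum.NE1p.DressedSmallFieldGeometry (torus_consts)
open Summit.QuantumFields.BalabanUV.T4Continuum.NE1p.DressedSmallFieldGeometryFaces (K₀_four)
open Summit.QuantumFields.BalabanUV.T4Continuum.NE1p.DressedSmallFieldCoresWitness (E1 crd liveTable VppM_liveTable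
  norm_liveTable_le coreW coreFam chi_coreW readOut_coreW_smul_liveTable N₁_coreW ctr0 hroom0 gaussian_E1 integrand_norm
  paramMass_coreW Acst Acst_pos cW cW_pos termsW termsW_X₀ hsmall_W incr incr_pos integrable_incr integral_incr_pos integrable_gauss_E1
  norm_cexp_readOut_le integrable_term)
open Summit.QuantumFields.BalabanUV.T4Continuum.NE1p.DressedSmallFieldOnCoresMass (attachedPart_locE_le_of_cores_pencil_mass
  muPart_locE_le_of_cores_mass)

/-! ## §1 The letter mass of W33's core in closed form: `λ(univ)·(wB·N₀·e^{bq})·(π∕(mq∕2))^{dim∕2} = |c|·√(2π)` — √2 × the exact mass -/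

/-- `finrank ℝ E1 = 1`. [folklore] -/
theorem finrank_E1 : Module.finrank ℝ E1 = 1 := by
  rw [finrank_euclideanSpace, Fintype.card_fin]

/-- `(π∕(1∕2))^{(dim E1)∕2} = √(2π)`. [folklore] -/
theorem letterGauss_E1 : (Real.pi / ((1 : ℝ) / 2)) ^ (Module.finrank ℝ E1 / 2 : ℝ) = Real.sqrt (2 * Real.pi) := by
  rw [finrank_E1, Nat.cast_one, Real.sqrt_eq_rpow]
  congr 1
  ring

/-- **THE LETTER MASS OF THE LIVE CORE** [decided toy]: at NE5's toy letters `(mq, bq, N₀) = (1, 0, 1)` the table-blind scalar of N0q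
(`OutputRateOpGaussianParam.paramMass` currency) is `1·(|c|·1·e⁰)·(π∕(1∕2))^{1∕2} = |c|·√(2π)` — Dirac mass `1`, weight letter `wB = |c|`.
[folklore] -/
theorem letterMass_coreW (c r : ℝ) (hr : 0 ≤ r) :
    (coreW c r hr).lam.real univ * ((coreW c r hr).wB * (1 : ℝ) * Real.exp (0 : ℝ)) *
        (Real.pi / ((1 : ℝ) / 2)) ^ (Module.finrank ℝ E1 / 2 : ℝ) = |c| * Real.sqrt (2 * Real.pi) := by
  rw [letterGauss_E1, Real.exp_zero, mul_one, mul_one]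
  show (Measure.dirac ()).real univ * |c| * Real.sqrt (2 * Real.pi) = _
  rw [probReal_univ, one_mul]

/-- **THE LOCATED `√2`** [arith]: the letter mass is `√2 ×` W33's EXACT Gaussian parameter mass `|c|·√π` (`paramMass_coreW`) — the price of
the half-margin majorant `e^{−(m∕2)‖v‖²}` behind `OutputRateOpGaussianParam.integral_paramMajorant`, per real fluctuation dimension. [folklore] -/
theorem letterMass_eq_sqrt_two_mul (c : ℝ) : |c| * Real.sqrt (2 * Real.pi) = Real.sqrt 2 * (|c| * Real.sqrt Real.pi) := by
  rw [Real.sqrt_mul (by norm_num : (0 : ℝ) ≤ 2)]; ring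

/-! ## §2 The weight that meets the LETTER budget, and the activity of record (toy DATA) -/

section Torus
variable (N : ℕ) [NeZero N] (r : ℝ) (hr : 0 ≤ r)

/-- The Cauchy weight for the letter budget `cM := A·e^{−2r}∕√(2π)` (toy DATA) — W33's `cW` divided by the located `√2`. [folklore] -/
def cM (r : ℝ) : ℝ := Acst * Real.exp (-(2 * r)) / Real.sqrt (2 * Real.pi)

/-- `0 < cM`. [folklore] -/
theorem cM_pos (r : ℝ) : 0 < cM r := by
  unfold cM; have := Acst_pos; have := Real.exp_pos (-(2 * r)); have : 0 < Real.sqrt (2 * Real.pi) := Real.sqrt_pos.2 (by positivity)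
  positivity

/-- `cM = cW ∕ √2`. [folklore] -/
theorem cM_eq_cW_div (r : ℝ) : cM r = cW r / Real.sqrt 2 := by
  unfold cM cW
  rw [Real.sqrt_mul (by norm_num : (0 : ℝ) ≤ 2), div_div, mul_comm (Real.sqrt Real.pi)]

/-- THE ACTIVITY OF RECORD for the letter budget (toy DATA): the sum of the cores' terms at weight `cM` along the pencil
`s ↦ 0 + s • liveTable` — BY DEFINITION (`hact`∕`hscale` by `rfl`, as in W33). [folklore] -/
def actM (k : ℕ) (s : ℂ) (Z : TDom 4 N) : ℂ :=
  ∑ i ∈ termsW N Z, termBi (coreFam (cM r) r hr) k i (0 : ℂ) ((0 : B13HistM toyFrame) + s • liveTable) k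

/-! ## §3 (B3) AS A LETTER BUDGET — `hM3` met at W24's located constant (attached-part form and μ-part form) -/

/-- **`hM3` FOR THE TABLE-STRENGTH PENCIL** (`ϱ = 2`, `R₀ = ‖0‖ + 2‖liveTable‖`) [decided toy]: at `X₀` the letter mass times the read-out growth is
`|cM|·√(2π)·e^{r·2‖liveTable‖} = A·e^{−2r(1−‖liveTable‖)} ≤ A = 0 + 2·(A∕2)` (decay factor `1`: `d(X₀) = 0`); vacuous elsewhere (no term). [folklore] -/
theorem hM3_M (k : ℕ) (R : ℝ) :
    ∀ Z : (tsys 4 N).Dom, (tgeometry 4 N).cubes Z ⊆ (tgeometry 4 N).cubes (X₀ N) →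
      ∑ i ∈ termsW N Z, (coreFam (cM r) r hr k i k).lam.real univ *
          ((coreFam (cM r) r hr k i k).wB * (fun (_ : ℕ) (_ : Unit) (_ : ℕ) => (1 : ℝ)) k i k *
            Real.exp ((fun (_ : ℕ) (_ : Unit) (_ : ℕ) => (0 : ℝ)) k i k)) *
          (Real.pi / ((fun (_ : ℕ) (_ : Unit) (_ : ℕ) => (1 : ℝ)) k i k / 2)) ^ (Module.finrank ℝ E1 / 2 : ℝ) *
        Real.exp ((coreFam (cM r) r hr k i k).N₁ * (‖(0 : B13HistM toyFrame)‖ + 2 * ‖liveTable‖)) ≤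
      (0 + 2 * (Acst / 2)) * Real.exp (-(R * (tsys 4 N).dj Z)) := by
  intro Z hZ
  have hZX : Z = X₀ N := (eq_X₀_iff N Z).1 ((Finset.Nonempty.subset_singleton_iff Z.2.1).1 hZ)
  subst hZX
  rw [termsW_X₀, Finset.sum_singleton]
  unfold coreFam
  rw [letterMass_coreW, N₁_coreW, norm_zero, zero_add]
  have hd : (tsys 4 N).dj (X₀ N) = 0 := by show torusTreeLen (X₀ N).1 = 0; rw [X₀_val]; exact torusTreeLen_singleton 0
  rw [hd, mul_zero, neg_zero, Real.exp_zero, mul_one, abs_of_pos (cM_pos r)]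
  have hT : ‖liveTable‖ ≤ 1 := norm_liveTable_le
  have h2π : 0 < Real.sqrt (2 * Real.pi) := Real.sqrt_pos.2 (by positivity)
  unfold cM
  rw [div_mul_cancel₀ _ h2π.ne']
  calc Acst * Real.exp (-(2 * r)) * Real.exp (r * (2 * ‖liveTable‖))
      = Acst * Real.exp (-(2 * r) + r * (2 * ‖liveTable‖)) := by rw [mul_assoc, ← Real.exp_add]
    _ ≤ Acst * Real.exp 0 := by
        gcongr
        · exact Acst_pos.le
        · nlinarith
    _ = 0 + 2 * (Acst / 2) := by rw [Real.exp_zero]; ring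

/-- **`hM3` FOR THE SOURCE PENCIL** (`R₀ = 2`, constant `A`) [decided toy]: `|cM|·√(2π)·e^{2r} = A` — EQUALITY at `X₀`. [folklore] -/
theorem hM3_mu (k : ℕ) (R : ℝ) :
    ∀ Z : (tsys 4 N).Dom, (tgeometry 4 N).cubes Z ⊆ (tgeometry 4 N).cubes (X₀ N) →
      ∑ i ∈ termsW N Z, (coreFam (cM r) r hr k i k).lam.real univ *
          ((coreFam (cM r) r hr k i k).wB * (fun (_ : ℕ) (_ : Unit) (_ : ℕ) => (1 : ℝ)) k i k *
            Real.exp ((fun (_ : ℕ) (_ : Unit) (_ : ℕ) => (0 : ℝ)) k i k)) *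
          (Real.pi / ((fun (_ : ℕ) (_ : Unit) (_ : ℕ) => (1 : ℝ)) k i k / 2)) ^ (Module.finrank ℝ E1 / 2 : ℝ) *
        Real.exp ((coreFam (cM r) r hr k i k).N₁ * 2) ≤
      Acst * Real.exp (-(R * (tsys 4 N).dj Z)) := by
  intro Z hZ
  have hZX : Z = X₀ N := (eq_X₀_iff N Z).1 ((Finset.Nonempty.subset_singleton_iff Z.2.1).1 hZ)
  subst hZX
  rw [termsW_X₀, Finset.sum_singleton]
  unfold coreFam
  rw [letterMass_coreW, N₁_coreW]
  have hd : (tsys 4 N).dj (X₀ N) = 0 := by show torusTreeLen (X₀ N).1 = 0; rw [X₀_val]; exact torusTreeLen_singleton 0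
  rw [hd, mul_zero, neg_zero, Real.exp_zero, mul_one, abs_of_pos (cM_pos r)]
  have h2π : 0 < Real.sqrt (2 * Real.pi) := Real.sqrt_pos.2 (by positivity)
  unfold cM
  rw [div_mul_cancel₀ _ h2π.ne', mul_assoc, ← Real.exp_add]
  have : -(2 * r) + r * 2 = 0 := by ring
  rw [this, Real.exp_zero, mul_one]

/-- The «ε small» clause at the constant `A` (μ-part form): W24's located clause (`hsmall_W` after `0 + 2·(A∕2) = A`). [folklore] -/
theorem hsmall_mu : Acst * Real.exp (0 + 1) * (tgeometry 4 N).K₀ * (tgeometry 4 N).ν * (tgeometry 4 N).c₁ ≤ 1 := by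
  have h := hsmall_W N
  rwa [show (0 : ℝ) + 2 * (Acst / 2) = Acst by ring] at h

/-! ## §4 THE ENDs FIRE: N0q's two letter-budget ENDs applied ONCE EACH BY NAME -/

open Classical in
/-- **N0q's `attachedPart_locE_le_of_cores_pencil_mass` FIRES ON THE LIVE CORE** [decided toy]: W33's core family at weight `cM`, W33's
`hroom0`∕`ctr0`, NE5's toy letters INLINE in the literal binder shapes, the two pencil radius inequalities, `hscale`∕`hact` by `rfl`, W24's
`hrate_torus`, W33's `hsmall_W`, `hM3_M`, `hϱ : 2 ≤ 2`, `hϱA`.  Conclusion LITERAL. [folklore] -/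
theorem coresMassEnd_fires (k : ℕ) :
    ‖locE (tgeometry 4 N).ι (tgeometry 4 N).cubes (actM N r hr k 1) ((tgeometry 4 N).cubes (X₀ N)) -
        locE (tgeometry 4 N).ι (tgeometry 4 N).cubes (actM N r hr k 0) ((tgeometry 4 N).cubes (X₀ N))‖ ≤
      4 * (Real.exp 1 * (tgeometry 4 N).ν * (tgeometry 4 N).c₁ * (tgeometry 4 N).K₀ ^ 2) * (Acst / 2) *
        Real.exp (-(0 * (tsys 4 N).dj (X₀ N))) :=
  attachedPart_locE_le_of_cores_pencil_mass (tsys 4 N) (tgeometry 4 N) (coreFam (cM r) r hr)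
    (W := Set.univ) (ctr := ctr0) (ROp := fun _ => 1) (RHist := fun _ => 2) (R' := fun _ => 2)
    (mq := fun _ _ _ => 1) (bq := fun _ _ _ => 0) (N₀ := fun _ _ _ => 1)
    hroom0 (fun _ _ _ _ _ _ _ => one_pos)
    (fun _ _ _ _ _ _ _ => ⟨fun _ _ => aestronglyMeasurable_const, fun _ => differentiableOn_const _, fun _ _ _ => by
      show ‖(1 : ℂ)‖ ≤ 1; rw [norm_one]⟩)
    (fun _ _ _ _ _ _ _ => ⟨fun _ _ => (Complex.measurable_ofReal.comp (measurable_snd.norm.pow_const 2)).aestronglyMeasurable,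
      fun _ _ => differentiableOn_const _, fun _ _ _ v => by show 1 * ‖v‖ ^ 2 - 0 ≤ (((‖v‖ ^ 2 : ℝ) : ℂ)).re; rw [Complex.ofReal_re]; simp⟩)
    (g := fun _ => 0) (Set.mem_univ _) (U := ()) (o := 0) (h₀ := 0) (w := liveTable) (ϱ := 2)
    (by show ‖(0 : ℂ) - 0‖ ≤ 1; simp)
    (by show ‖(0 : B13HistM toyFrame) - 0‖ + 2 * ‖liveTable‖ ≤ 2; rw [sub_zero, norm_zero, zero_add];
        linarith [norm_liveTable_le])
    (emb := fun _ => k) (fun _ => rfl) (terms := termsW N) (act := actM N r hr k) (fun _ _ _ => rfl)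
    (A₀ := 0) (A₁ := Acst / 2) (R := 2 * (tgeometry 4 N).κ₀ + 2) (r₁ := 0) (b₅ := 0) (X₀ := X₀ N)
    le_rfl (by have := Acst_pos; positivity) le_rfl (by norm_num) (hrate_torus N) (hsmall_W N) (hM3_M N r hr k _)
    le_rfl (by have := Acst_pos; linarith)

open Classical in
/-- … in CLOSED FORM: `≤ 2·K₀(64,8)` (pv22's constants BY NAME). [folklore] -/
theorem coresMassEnd_fires_closed (k : ℕ) :
    ‖locE (tgeometry 4 N).ι (tgeometry 4 N).cubes (actM N r hr k 1) ((tgeometry 4 N).cubes (X₀ N)) -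
        locE (tgeometry 4 N).ι (tgeometry 4 N).cubes (actM N r hr k 0) ((tgeometry 4 N).cubes (X₀ N))‖ ≤ 2 * K₀ 64 8 := by
  refine (coresMassEnd_fires N r hr k).trans (le_of_eq ?_)
  rw [(torus_consts N).1, (torus_consts N).2.2, K₀_four, zero_mul, neg_zero, Real.exp_zero, mul_one]
  unfold Acst
  have hK := K₀_pos (64 : ℝ) 8
  have he := Real.exp_pos 1
  field_simp
  ring

open Classical in
/-- **N0q's `muPart_locE_le_of_cores_mass` FIRES ON THE LIVE CORE** [decided toy]: the SAME activity read along the SOURCE pencil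
`s ↦ 0 + s • liveTable` on `‖s‖ < μ₁` with `μ₁ ≤ 2` (so the pencil stays in NE5's class of history radius `2` and has table radius
`R₀ := 2`), `hM3_mu` with EQUALITY at `X₀`, `hsmall_mu`; for `0 < μ₀ < μ₁`, `‖μ‖ ≤ μ₀`.  Conclusion LITERAL. [folklore] -/
theorem coresMuEnd_fires {μ₁ μ₀ : ℝ} {μ : ℂ} (hμ₁ : μ₁ ≤ 2) (h0 : 0 < μ₀) (h01 : μ₀ < μ₁) (hμ : ‖μ‖ ≤ μ₀) (k : ℕ) :
    ‖locE (tgeometry 4 N).ι (tgeometry 4 N).cubes (actM N r hr k μ) ((tgeometry 4 N).cubes (X₀ N)) -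
        locE (tgeometry 4 N).ι (tgeometry 4 N).cubes (actM N r hr k 0) ((tgeometry 4 N).cubes (X₀ N))‖ ≤
      Real.exp 1 * (tgeometry 4 N).ν * (tgeometry 4 N).c₁ * (tgeometry 4 N).K₀ ^ 2 * Acst *
        Real.exp (-(0 * (tsys 4 N).dj (X₀ N))) * (μ₀ / (μ₁ - μ₀)) := by
  have hT : ‖liveTable‖ ≤ 1 := norm_liveTable_le
  have hμ₁0 : 0 ≤ μ₁ := (h0.trans h01).le
  have hpen : ∀ s ∈ ball (0 : ℂ) μ₁, ‖(0 : B13HistM toyFrame) + s • liveTable‖ ≤ 2 := fun s hs => by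
    rw [zero_add, norm_smul]
    rw [mem_ball_zero_iff] at hs
    calc ‖s‖ * ‖liveTable‖ ≤ μ₁ * 1 :=
          mul_le_mul hs.le hT (norm_nonneg _) hμ₁0
      _ ≤ 2 := by linarith
  exact muPart_locE_le_of_cores_mass (tsys 4 N) (tgeometry 4 N) (coreFam (cM r) r hr)
    (W := Set.univ) (ctr := ctr0) (ROp := fun _ => 1) (RHist := fun _ => 2) (R' := fun _ => 2)
    (mq := fun _ _ _ => 1) (bq := fun _ _ _ => 0) (N₀ := fun _ _ _ => 1)
    hroom0 (fun _ _ _ _ _ _ _ => one_pos)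
    (fun _ _ _ _ _ _ _ => ⟨fun _ _ => aestronglyMeasurable_const, fun _ => differentiableOn_const _, fun _ _ _ => by
      show ‖(1 : ℂ)‖ ≤ 1; rw [norm_one]⟩)
    (fun _ _ _ _ _ _ _ => ⟨fun _ _ => (Complex.measurable_ofReal.comp (measurable_snd.norm.pow_const 2)).aestronglyMeasurable,
      fun _ _ => differentiableOn_const _, fun _ _ _ v => by show 1 * ‖v‖ ^ 2 - 0 ≤ (((‖v‖ ^ 2 : ℝ) : ℂ)).re; rw [Complex.ofReal_re]; simp⟩)
    (g := fun _ => 0) (Set.mem_univ _) (U := ()) (o := 0) (hc := fun s : ℂ => (0 : B13HistM toyFrame) + s • liveTable) (R₀ := 2)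
    ((differentiable_const _).add (differentiable_id.smul_const _)).differentiableOn
    (fun s hs => Set.mk_mem_prod (mem_closedBall.2 (by show dist (0 : ℂ) 0 ≤ 1; simp))
      (mem_closedBall.2 (by show dist ((0 : B13HistM toyFrame) + s • liveTable) 0 ≤ 2; rw [dist_zero_right]; exact hpen s hs)))
    hpen (emb := fun _ => k) (fun _ => rfl) (terms := termsW N) (act := actM N r hr k) (fun _ _ _ => rfl)
    (A := Acst) (R := 2 * (tgeometry 4 N).κ₀ + 2) (r₁ := 0) (b₅ := 0) (X₀ := X₀ N)
    Acst_pos.le le_rfl (by norm_num) (hrate_torus N) (hsmall_mu N) (hM3_mu N r hr k _) h0 h01 hμ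

open Classical in
/-- … in CLOSED FORM: the μ-part is `≤ K₀(64,8)·μ₀∕(μ₁ − μ₀)`. [folklore] -/
theorem coresMuEnd_fires_closed {μ₁ μ₀ : ℝ} {μ : ℂ} (hμ₁ : μ₁ ≤ 2) (h0 : 0 < μ₀) (h01 : μ₀ < μ₁) (hμ : ‖μ‖ ≤ μ₀) (k : ℕ) :
    ‖locE (tgeometry 4 N).ι (tgeometry 4 N).cubes (actM N r hr k μ) ((tgeometry 4 N).cubes (X₀ N)) -
        locE (tgeometry 4 N).ι (tgeometry 4 N).cubes (actM N r hr k 0) ((tgeometry 4 N).cubes (X₀ N))‖ ≤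
      K₀ 64 8 * (μ₀ / (μ₁ - μ₀)) := by
  refine (coresMuEnd_fires N r hr hμ₁ h0 h01 hμ k).trans (le_of_eq ?_)
  rw [(torus_consts N).1, (torus_consts N).2.2, K₀_four, zero_mul, neg_zero, Real.exp_zero, mul_one]
  unfold Acst
  have hK := K₀_pos (64 : ℝ) 8
  have he := Real.exp_pos 1
  field_simp

/-! ## §5 GENUINE: the attached part AND the μ-part of the letter-budget activity are NOT zero -/

/-- THE TERM IN CLOSED FORM at weight `cM` [decided toy]: `termBi coreFam k () 0 (0 + s•liveTable) X = cM·∫ e^{s·r·e^{−(v 0)²}}·e^{−‖v‖²} dv`.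
[folklore] -/
theorem termBi_coreFam_M (k : ℕ) (s : ℂ) (X : ℕ) :
    termBi (coreFam (cM r) r hr) k () (0 : ℂ) ((0 : B13HistM toyFrame) + s • liveTable) X =
      (cM r : ℂ) * ∫ v : E1, cexp (s * ((r : ℂ) * (Real.exp (-(crd v ^ 2)) : ℂ))) * cexp (-(((‖v‖ ^ 2 : ℝ) : ℂ))) := by
  unfold termBi
  show ∫ p, (coreW (cM r) r hr).w p * (coreW (cM r) r hr).N 0 p *
      ∫ v, (coreW (cM r) r hr).chi v * cexp ((coreW (cM r) r hr).readOut p v (0 + s • liveTable)) *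
        cexp (-(coreW (cM r) r hr).q 0 p v) ∂volume ∂(coreW (cM r) r hr).lam = _
  simp_rw [chi_coreW, zero_add, readOut_coreW_smul_liveTable, one_mul]
  show ∫ p, (cM r : ℂ) * 1 * ∫ v, cexp (s * ((r : ℂ) * (Real.exp (-(crd v ^ 2)) : ℂ))) *
      cexp (-(((‖v‖ ^ 2 : ℝ) : ℂ))) ∂volume ∂(Measure.dirac ()) = _
  rw [integral_dirac, mul_one]

/-- **THE INCREMENT AT A REAL SOURCE `t` IN CLOSED FORM** [decided toy]: `act t X₀ − act 0 X₀ = cM·∫ incr (t·r)` — W33's increment density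
at contour radius `t·r`. [folklore] -/
theorem actM_real_sub_zero (k : ℕ) (t : ℝ) :
    actM N r hr k (t : ℂ) (X₀ N) - actM N r hr k 0 (X₀ N) = (cM r : ℂ) * ((∫ v, incr (t * r) v : ℝ) : ℂ) := by
  unfold actM
  rw [termsW_X₀, Finset.sum_singleton, Finset.sum_singleton, termBi_coreFam_M, termBi_coreFam_M, ← mul_sub,
    ← integral_sub (integrable_term r hr (t : ℂ)) (integrable_term r hr 0), ← integral_complex_ofReal]
  congr 1
  refine integral_congr_ae (Filter.Eventually.of_forall fun v => ?_)
  simp only [incr, zero_mul, Complex.exp_zero]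
  push_cast
  ring_nf

/-- **THE μ-PART AT A REAL POSITIVE SOURCE IS NOT ZERO** (`cM > 0`, `∫ incr (t·r) > 0` for `0 < t`, `0 < r`). [folklore] -/
theorem actM_mu_live (hr0 : 0 < r) {t : ℝ} (ht : 0 < t) (k : ℕ) : actM N r hr k (t : ℂ) (X₀ N) ≠ actM N r hr k 0 (X₀ N) := by
  intro h
  have h0 := sub_eq_zero.2 h
  rw [actM_real_sub_zero] at h0
  rcases mul_eq_zero.1 h0 with hc | hI
  · exact (cM_pos r).ne' (by exact_mod_cast hc)
  · exact (integral_incr_pos (t * r) (mul_pos ht hr0)).ne' (by exact_mod_cast hI)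

/-- **THE ATTACHED PART IS NOT ZERO** — the source `t = 1`. [folklore] -/
theorem actM_live (hr0 : 0 < r) (k : ℕ) : actM N r hr k 1 (X₀ N) ≠ actM N r hr k 0 (X₀ N) := by
  simpa using actM_mu_live N r hr hr0 one_pos k

/-- The activities at `X₀` are SMALL along the pencil: `‖act s X₀‖ ≤ A·e^{−2r}·e^{‖s‖r}∕√(2π)·√π`, hence `< 1` for `‖s‖ ≤ 2`
(`A ≤ 1` = W24's `dressedConst_le_one`, and `√π < √(2π)`). [folklore] -/
theorem norm_actM_X₀_lt_one (k : ℕ) {s : ℂ} (hs : ‖s‖ ≤ 2) : ‖actM N r hr k s (X₀ N)‖ < 1 := by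
  unfold actM
  rw [termsW_X₀, Finset.sum_singleton, termBi_coreFam_M, norm_mul, Complex.norm_real, Real.norm_eq_abs, abs_of_pos (cM_pos r)]
  have hb : ∀ v : E1, ‖cexp (s * ((r : ℂ) * (Real.exp (-(crd v ^ 2)) : ℂ))) * cexp (-(((‖v‖ ^ 2 : ℝ) : ℂ)))‖ ≤
      Real.exp (‖s‖ * r) * Real.exp (-‖v‖ ^ 2) := fun v => by
    rw [norm_mul, ← Complex.ofReal_neg, Complex.norm_exp_ofReal]
    exact mul_le_mul_of_nonneg_right (norm_cexp_readOut_le r hr s v) (Real.exp_pos _).le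
  have hI := norm_integral_le_of_norm_le ((integrable_gauss_E1).const_mul (Real.exp (‖s‖ * r))) (Filter.Eventually.of_forall hb)
  rw [integral_const_mul, gaussian_E1] at hI
  have hπ : 0 < Real.sqrt Real.pi := Real.sqrt_pos.2 Real.pi_pos
  have h2π : Real.sqrt Real.pi < Real.sqrt (2 * Real.pi) :=
    Real.sqrt_lt_sqrt Real.pi_pos.le (by linarith [Real.pi_pos])
  have hA : Acst ≤ 1 := dressedConst_le_one
  have hApos := Acst_pos
  have he : Real.exp (-(2 * r)) * Real.exp (‖s‖ * r) ≤ 1 := by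
    rw [← Real.exp_add, Real.exp_le_one_iff]; nlinarith
  calc cM r * ‖∫ v : E1, cexp (s * ((r : ℂ) * (Real.exp (-(crd v ^ 2)) : ℂ))) * cexp (-(((‖v‖ ^ 2 : ℝ) : ℂ)))‖
      ≤ cM r * (Real.exp (‖s‖ * r) * Real.sqrt Real.pi) := by gcongr; exact (cM_pos r).le
    _ = Acst * (Real.exp (-(2 * r)) * Real.exp (‖s‖ * r)) * (Real.sqrt Real.pi / Real.sqrt (2 * Real.pi)) := by
        unfold cM; field_simp
    _ ≤ 1 * 1 * (Real.sqrt Real.pi / Real.sqrt (2 * Real.pi)) := by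
        have hq : 0 ≤ Real.sqrt Real.pi / Real.sqrt (2 * Real.pi) := div_nonneg hπ.le (hπ.le.trans h2π.le)
        have hprod : Acst * (Real.exp (-(2 * r)) * Real.exp (‖s‖ * r)) ≤ 1 * 1 :=
          mul_le_mul hA he (by positivity) zero_le_one
        exact mul_le_mul_of_nonneg_right hprod hq
    _ < 1 := by rw [one_mul, one_mul, div_lt_one (hπ.trans h2π)]; exact h2π

open Classical in
/-- **THE μ-END's BOUNDED QUANTITY IS NOT ZERO** for a REAL source `0 < t ≤ 2` [decided toy] (via W24's `exp_locE_cube`). [folklore] -/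
theorem coresMuEnd_live (hr0 : 0 < r) {t : ℝ} (ht : 0 < t) (ht2 : t ≤ 2) (k : ℕ) :
    locE (tgeometry 4 N).ι (tgeometry 4 N).cubes (actM N r hr k (t : ℂ)) ((tgeometry 4 N).cubes (X₀ N)) ≠
      locE (tgeometry 4 N).ι (tgeometry 4 N).cubes (actM N r hr k 0) ((tgeometry 4 N).cubes (X₀ N)) := by
  intro h
  have ht' : ‖(t : ℂ)‖ ≤ 2 := by rw [Complex.norm_real, Real.norm_eq_abs, abs_of_pos ht]; exact ht2
  have h1 := exp_locE_cube N (w := actM N r hr k (t : ℂ)) (norm_actM_X₀_lt_one N r hr k ht')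
  have h0 := exp_locE_cube N (w := actM N r hr k 0) (norm_actM_X₀_lt_one N r hr k (by simp))
  have h' : cexp (locE (TTouch (d := 4) (N := N)) (fun Z : (tsys 4 N).Dom => Z.1) (actM N r hr k (t : ℂ)) {0}) =
      cexp (locE (TTouch (d := 4) (N := N)) (fun Z : (tsys 4 N).Dom => Z.1) (actM N r hr k 0) {0}) := congrArg cexp h
  rw [h1, h0, add_right_inj] at h'
  exact actM_mu_live N r hr hr0 ht k h'

open Classical in
/-- **THE END's BOUNDED QUANTITY IS NOT ZERO (attached part)** — the source `t = 1`. [folklore] -/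
theorem coresMassEnd_live (hr0 : 0 < r) (k : ℕ) :
    locE (tgeometry 4 N).ι (tgeometry 4 N).cubes (actM N r hr k 1) ((tgeometry 4 N).cubes (X₀ N)) ≠
      locE (tgeometry 4 N).ι (tgeometry 4 N).cubes (actM N r hr k 0) ((tgeometry 4 N).cubes (X₀ N)) := by
  simpa using coresMuEnd_live N r hr hr0 one_pos (by norm_num : (1 : ℝ) ≤ 2) k

end Torus

end Summit.QuantumFields.BalabanUV.T4Continuum.NE1p.DressedSmallFieldCoresMassWitness

end
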